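import Literature.NumberTheory.DiophantineGeometry.AbcStewartYu2001EpsShapeProofs
import HarnessLib

/-!
# The pencil engine, I: one member of a binary pencil (Stewart–Yu 2001, Theorem 2, transferred)

`Summits/ABC/ABC/Theorems/TwoSixPencilPencilBoundMember.lean` — helper file for the crux
`Summit.ABC.ABC.Theses.TwoSixPencil.PencilBound` (stmt-ABC-24782, the GENERAL PENCIL THEOREM; its
`k = 4` instance is `Summit.ABC.ABC.Theses.RationalCuspPencil.PencilFourBound`, stmt-ABC-24549).

Content (all [folklore] plumbing around the tree's typed Stewart–Yu 2001 Theorem 2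
`Literature.NumberTheory.DiophantineGeometry.stewartYu2001_thm2`, taken here as a HYPOTHESIS `hSY`
and discharged in the closing files by `Summit.ABC.ABC.Theorems.stewartYu2001_thm2_holds`):

* small API for `Literature.Barriers.ABC.largestPrimeFactor` (`P(n)`, `P(0) = P(1) = 1`):
  `P(n) ≤ n`, monotone under divisibility, `P(mn) ≤ P(m) P(n)`, `P(n) = 1` or a prime factor;
* `exists_abcTriple_of_int_sum`: a coprime integer solution of `x + y = z` rearranges into an
  abc triple `(p, q, r)` with `pqr = |xyz|`, `|x|, |y|, |z| ≤ r` and `p′ ≤ P(|x|)`;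
* `log_le_pmin_uniform`: Theorem 2 in the `ε`-form `log r ≤ K(ε) · p′ · G^ε` for ALL abc triples
  (the tree's `StewartYu2001.log_lt_const_mul_pmin_mul_rpow` has `r > 2`; `r ≤ 2` is absorbed);
* `log_le_of_int_sum`: the same for coprime integer solutions of `x + y = z`, member `x` singled
  out: `log max(|x|,|y|,|z|) ≤ K · P(|x|) · rad(xyz)^ε`;
* `member_bound` — **the per-member pencil bound**: for three pairwise non-proportional integral
  linear forms `Lᵢ = aᵢ u + bᵢ w` and every `ε > 0` there is `K ≥ 0` with
  `log max(|u|,|w|) ≤ K · P(L₁(u,w)) · rad(N)^ε` for all coprime `u, w` and every nonzero `N`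
  divisible by `L₁L₂L₃(u,w)`. Proof: the sub-pencil identity `D₂₃L₁ + D₃₁L₂ + D₁₂L₃ = 0`
  (`Dᵢⱼ = aᵢbⱼ − aⱼbᵢ`), the gcd of the three terms divides `D₂₃D₃₁D₁₂` (Cramer + `gcd(u,w) = 1`),
  so after dividing it out Theorem 2 applies with `p′ ≤ P(D₂₃L₁) ≤ |D₂₃| P(L₁)` and
  `G ≤ |D₂₃D₃₁D₁₂| · rad N`, while `max(|u|,|w|) ≤ (Σ|coeff| + 1) |D₂₃D₃₁D₁₂| · r` by Cramer.

HONESTY: bookkeeping around a PROVED theorem of the tree; the class ε-shapes it serves (exponent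
`1/k` on a torsion class) are NOT abc, NOT A-PS (polynomial Szpiro), NOT rung A1′.
References: [StewartYu2001] Thm 2 and the remark after it; [Sheppard2016] §2.4 (p. 23).
-/

set_option linter.dupNamespace false

noncomputable section

open UniqueFactorizationMonoid Finset
open Literature.NumberTheory.DiophantineGeometry Literature.Barriers.ABC
open Literature.NumberTheory.DiophantineGeometry.StewartYu2001

namespace Summit.ABC.ABC.Theorems.PencilBoundLine

/-! ### The largest prime factor `P(n)` -/

/-- `P(n) ≤ n` for `n ≠ 0`. [folklore] -/
theorem largestPrimeFactor_le_self {n : ℕ} (hn : n ≠ 0) : largestPrimeFactor n ≤ n := by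
  rw [largestPrimeFactor_def]
  refine max_le (Nat.one_le_iff_ne_zero.mpr hn) (Finset.sup_le fun p hp => ?_)
  exact Nat.le_of_dvd (Nat.pos_of_ne_zero hn) (Nat.dvd_of_mem_primeFactors hp)

/-- `P` is monotone under divisibility: `m ∣ n ≠ 0 ⇒ P(m) ≤ P(n)`. [folklore] -/
theorem largestPrimeFactor_mono {m n : ℕ} (h : m ∣ n) (hn : n ≠ 0) :
    largestPrimeFactor m ≤ largestPrimeFactor n := by
  rw [largestPrimeFactor_def, largestPrimeFactor_def]
  exact max_le_max le_rfl (Finset.sup_mono (Nat.primeFactors_mono h hn))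

/-- `P(mn) ≤ P(m) · P(n)` (indeed `= max`, both factors being `≥ 1`). [folklore] -/
theorem largestPrimeFactor_mul_le (m n : ℕ) :
    largestPrimeFactor (m * n) ≤ largestPrimeFactor m * largestPrimeFactor n := by
  classical
  have h1 := one_le_largestPrimeFactor m
  have h2 := one_le_largestPrimeFactor n
  have h12 : 1 ≤ largestPrimeFactor m * largestPrimeFactor n := Nat.one_le_iff_ne_zero.mpr (by positivity)
  have h0 : largestPrimeFactor 0 = 1 := by
    rw [largestPrimeFactor_def, Nat.primeFactors_zero, Finset.sup_empty]; rfl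
  rcases eq_or_ne m 0 with rfl | hm
  · rw [zero_mul, h0, one_mul]; exact h2
  rcases eq_or_ne n 0 with rfl | hn
  · rw [mul_zero, h0, mul_one]; exact h1
  have hm' : m.primeFactors.sup id ≤ largestPrimeFactor m := by
    rw [largestPrimeFactor_def]; exact le_max_right _ _
  have hn' : n.primeFactors.sup id ≤ largestPrimeFactor n := by
    rw [largestPrimeFactor_def]; exact le_max_right _ _
  rw [largestPrimeFactor_def (m * n), Nat.primeFactors_mul hm hn, Finset.sup_union]
  refine max_le h12 (sup_le ?_ ?_)
  · exact hm'.trans (Nat.le_mul_of_pos_right _ h2)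
  · exact hn'.trans (Nat.le_mul_of_pos_left _ h1)

/-- `P(n) = 1`, or `P(n)` is a prime dividing `n`. [folklore] -/
theorem largestPrimeFactor_eq_one_or_prime (n : ℕ) :
    largestPrimeFactor n = 1 ∨ ((largestPrimeFactor n).Prime ∧ largestPrimeFactor n ∣ n) := by
  by_cases hn : n.primeFactors.Nonempty
  · have h := largestPrimeFactor_mem hn
    exact Or.inr ⟨Nat.prime_of_mem_primeFactors h, Nat.dvd_of_mem_primeFactors h⟩
  · left
    rw [Finset.not_nonempty_iff_eq_empty] at hn
    rw [largestPrimeFactor_def, hn, Finset.sup_empty]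
    rfl

/-! ### Sign normalisation: an integer solution of `x + y = z` as an abc triple -/

/-- A solution of `x + y = z` in nonzero integers with `gcd(x, y) = 1` rearranges into an abc
triple `(p, q, r)` with `pqr = |xyz|`, `|x|, |y|, |z| ≤ r` and `p′ ≤ P(|x|)` (the member `x`
is one of `p, q, r`). [folklore] -/
theorem exists_abcTriple_of_int_sum {x y z : ℤ} (hsum : x + y = z) (hx : x ≠ 0) (hy : y ≠ 0)
    (hz : z ≠ 0) (hcop : IsCoprime x y) :
    ∃ p q r : ℕ, IsABCTriple p q r ∧ p * q * r = (x * y * z).natAbs ∧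
      x.natAbs ≤ r ∧ y.natAbs ≤ r ∧ z.natAbs ≤ r ∧ pmin p q r ≤ largestPrimeFactor x.natAbs := by
  have hyz : IsCoprime y z := by
    have := hcop.symm.add_mul_left_right 1; rwa [mul_one, hsum] at this
  have hxz : IsCoprime x z := by
    have := hcop.add_mul_left_right 1; rwa [mul_one, add_comm, hsum] at this
  have cxy : Nat.Coprime x.natAbs y.natAbs := by
    rw [Nat.Coprime, ← Int.gcd_eq_natAbs]; exact Int.isCoprime_iff_gcd_eq_one.mp hcop
  have cyz : Nat.Coprime y.natAbs z.natAbs := by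
    rw [Nat.Coprime, ← Int.gcd_eq_natAbs]; exact Int.isCoprime_iff_gcd_eq_one.mp hyz
  have cxz : Nat.Coprime x.natAbs z.natAbs := by
    rw [Nat.Coprime, ← Int.gcd_eq_natAbs]; exact Int.isCoprime_iff_gcd_eq_one.mp hxz
  have hprod1 : x.natAbs * y.natAbs * z.natAbs = (x * y * z).natAbs := by
    rw [Int.natAbs_mul, Int.natAbs_mul]
  have hx' := Int.natAbs_pos.mpr hx
  have hy' := Int.natAbs_pos.mpr hy
  have hz' := Int.natAbs_pos.mpr hz
  have hPx : pmin x.natAbs y.natAbs z.natAbs ≤ largestPrimeFactor x.natAbs := by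
    rw [pmin_def]; exact min_le_left _ _
  have hPy : pmin y.natAbs z.natAbs x.natAbs ≤ largestPrimeFactor x.natAbs := by
    rw [pmin_def]; exact (min_le_right _ _).trans (min_le_right _ _)
  have hPz : pmin x.natAbs z.natAbs y.natAbs ≤ largestPrimeFactor x.natAbs := by
    rw [pmin_def]; exact min_le_left _ _
  -- three shapes
  by_cases h1 : x.natAbs + y.natAbs = z.natAbs
  · exact ⟨x.natAbs, y.natAbs, z.natAbs, ⟨hx', hy', h1, cxy⟩, hprod1, by omega, by omega, le_rfl,
      hPx⟩
  by_cases h2 : y.natAbs + z.natAbs = x.natAbs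
  · refine ⟨y.natAbs, z.natAbs, x.natAbs, ⟨hy', hz', h2, cyz⟩, ?_, le_rfl, by omega, by omega, hPy⟩
    rw [← hprod1]; ring
  have h3 : x.natAbs + z.natAbs = y.natAbs := by omega
  refine ⟨x.natAbs, z.natAbs, y.natAbs, ⟨hx', hz', h3, cxz⟩, ?_, by omega, le_rfl, by omega, hPz⟩
  rw [← hprod1]; ring

/-! ### Theorem 2, `ε`-form, on all abc triples and on integer solutions -/

/-- Theorem 2 in the `ε`-form with a uniform constant and NO size condition: if Theorem 2 holds
then for every `ε > 0` there is `K > 0` with `log r ≤ K · p′ · G^ε` for every abc triple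
`p + q = r` (for `r ≤ 2`: `log r ≤ log 2 ≤ log 2 · p′ · G^ε`).
[cite: StewartYu2001, Theorem 2 and the remark after it] -/
theorem log_le_pmin_uniform (hSY : stewartYu2001_thm2) {ε : ℝ} (hε : 0 < ε) :
    ∃ K : ℝ, 0 < K ∧ ∀ p q r : ℕ, IsABCTriple p q r →
      Real.log r ≤ K * pmin p q r * (rad p q r : ℝ) ^ ε := by
  obtain ⟨K, hK, hb⟩ := log_lt_const_mul_pmin_mul_rpow hSY hε
  have hlog2 : 0 ≤ Real.log 2 := Real.log_nonneg (by norm_num)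
  refine ⟨max K (Real.log 2), lt_max_of_lt_left hK, fun p q r h => ?_⟩
  have hp1 : (1 : ℝ) ≤ pmin p q r := by exact_mod_cast one_le_pmin p q r
  have hR1 : (1 : ℝ) ≤ (rad p q r : ℝ) ^ ε := Real.one_le_rpow (one_le_rad_real p q r) hε.le
  have hKm : 0 ≤ max K (Real.log 2) := le_max_of_le_right hlog2
  have hprod : 1 ≤ (pmin p q r : ℝ) * (rad p q r : ℝ) ^ ε := one_le_mul_of_one_le_of_one_le hp1 hR1
  by_cases hr : 2 < r
  · calc Real.log r ≤ K * pmin p q r * (rad p q r : ℝ) ^ ε := (hb p q r h hr).le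
      _ = K * (pmin p q r * (rad p q r : ℝ) ^ ε) := by ring
      _ ≤ max K (Real.log 2) * (pmin p q r * (rad p q r : ℝ) ^ ε) :=
          mul_le_mul_of_nonneg_right (le_max_left _ _) (by positivity)
      _ = max K (Real.log 2) * pmin p q r * (rad p q r : ℝ) ^ ε := by ring
  · push Not at hr
    have hlogr : Real.log r ≤ Real.log 2 := by
      rcases Nat.eq_zero_or_pos r with h0 | hpos
      · rw [h0, Nat.cast_zero, Real.log_zero]; exact hlog2
      · exact Real.log_le_log (by exact_mod_cast hpos) (by exact_mod_cast hr)
    calc Real.log r ≤ Real.log 2 := hlogr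
      _ ≤ max K (Real.log 2) := le_max_right _ _
      _ ≤ max K (Real.log 2) * (pmin p q r * (rad p q r : ℝ) ^ ε) :=
          le_mul_of_one_le_right hKm hprod
      _ = max K (Real.log 2) * pmin p q r * (rad p q r : ℝ) ^ ε := by ring

/-- Theorem 2 on coprime integer solutions of `x + y = z`, member `x` singled out: there is
`r ≥ |x|, |y|, |z|` (namely `max`) with `log r ≤ K · P(|x|) · rad(xyz)^ε`.
[cite: StewartYu2001, Theorem 2 and the remark after it] -/
theorem log_le_of_int_sum (hSY : stewartYu2001_thm2) {ε : ℝ} (hε : 0 < ε) :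
    ∃ K : ℝ, 0 < K ∧ ∀ x y z : ℤ, x ≠ 0 → y ≠ 0 → z ≠ 0 → x + y = z → IsCoprime x y →
      ∃ r : ℕ, x.natAbs ≤ r ∧ y.natAbs ≤ r ∧ z.natAbs ≤ r ∧
        Real.log r ≤ K * largestPrimeFactor x.natAbs *
          ((radical (x * y * z).natAbs : ℕ) : ℝ) ^ ε := by
  obtain ⟨K, hK, hb⟩ := log_le_pmin_uniform hSY hε
  refine ⟨K, hK, fun x y z hx hy hz hsum hcop => ?_⟩
  obtain ⟨p, q, r, hT, hprod, hxr, hyr, hzr, hP⟩ := exists_abcTriple_of_int_sum hsum hx hy hz hcop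
  refine ⟨r, hxr, hyr, hzr, ?_⟩
  have hrad : rad p q r = radical (x * y * z).natAbs := by rw [rad_def, hprod]
  have h1 := hb p q r hT
  rw [hrad] at h1
  have hP' : (pmin p q r : ℝ) ≤ largestPrimeFactor x.natAbs := by exact_mod_cast hP
  calc Real.log r ≤ K * pmin p q r * ((radical (x * y * z).natAbs : ℕ) : ℝ) ^ ε := h1
    _ ≤ K * largestPrimeFactor x.natAbs * ((radical (x * y * z).natAbs : ℕ) : ℝ) ^ ε := by
        gcongr

/-! ### The per-member pencil bound -/

/-- **Per-member pencil bound.** Let `Lᵢ = aᵢ u + bᵢ w` (`i = 1, 2, 3`) be pairwise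
non-proportional integral linear forms (`aᵢ bⱼ ≠ aⱼ bᵢ`). If Stewart–Yu's Theorem 2 holds, then
for every `ε > 0` there is `K ≥ 0` (depending on `ε` and the forms) such that for all coprime
integers `u, w` and every nonzero integer `N` divisible by `L₁L₂L₃(u, w)`:
`log max(|u|, |w|) ≤ K · P(|L₁(u,w)|) · rad(N)^ε`.
(Sub-pencil identity `D₂₃L₁ + D₃₁L₂ + D₁₂L₃ = 0`, gcd dividing `D₂₃D₃₁D₁₂`, Theorem 2 with
`p′ ≤ |D₂₃| P(L₁)`, Cramer for the height.) [cite: StewartYu2001, Theorem 2 and the remark after it] -/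
theorem member_bound (hSY : stewartYu2001_thm2) {ε : ℝ} (hε : 0 < ε)
    {a₁ b₁ a₂ b₂ a₃ b₃ : ℤ} (h12 : a₁ * b₂ ≠ a₂ * b₁) (h23 : a₂ * b₃ ≠ a₃ * b₂)
    (h13 : a₁ * b₃ ≠ a₃ * b₁) :
    ∃ K : ℝ, 0 ≤ K ∧ ∀ u w N : ℤ, IsCoprime u w → N ≠ 0 →
      (a₁ * u + b₁ * w) * (a₂ * u + b₂ * w) * (a₃ * u + b₃ * w) ∣ N →
      Real.log ((max |u| |w| : ℤ) : ℝ) ≤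
        K * largestPrimeFactor (a₁ * u + b₁ * w).natAbs * (((radical N).natAbs : ℕ) : ℝ) ^ ε := by
  obtain ⟨K₁, hK₁, hB⟩ := log_le_of_int_sum hSY hε
  -- the three resultants
  have hD12 : a₁ * b₂ - a₂ * b₁ ≠ 0 := sub_ne_zero.mpr h12
  have hD23 : a₂ * b₃ - a₃ * b₂ ≠ 0 := sub_ne_zero.mpr h23
  have hD31 : a₃ * b₁ - a₁ * b₃ ≠ 0 := sub_ne_zero.mpr h13.symm
  set D : ℤ := (a₂ * b₃ - a₃ * b₂) * (a₃ * b₁ - a₁ * b₃) * (a₁ * b₂ - a₂ * b₁) with hDdef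
  have hD0 : D ≠ 0 := mul_ne_zero (mul_ne_zero hD23 hD31) hD12
  have hDabs : 0 < D.natAbs := Int.natAbs_pos.mpr hD0
  set S : ℕ := a₁.natAbs + b₁.natAbs + a₂.natAbs + b₂.natAbs + 1 with hSdef
  have hS0 : 0 < S := Nat.succ_pos _
  have hS1 : b₂.natAbs + b₁.natAbs ≤ S :=
    le_of_le_of_eq (Nat.le_add_left _ (a₁.natAbs + a₂.natAbs + 1)) (by rw [hSdef]; ring)
  have hS2 : a₁.natAbs + a₂.natAbs ≤ S :=
    le_of_le_of_eq (Nat.le_add_left _ (b₁.natAbs + b₂.natAbs + 1)) (by rw [hSdef]; ring)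
  set T : ℕ := S * D.natAbs with hTdef
  have hT1 : 1 ≤ T := Nat.mul_pos hS0 hDabs
  have hlogT : 0 ≤ Real.log T := Real.log_nonneg (by exact_mod_cast hT1)
  refine ⟨Real.log T + K₁ * (a₂ * b₃ - a₃ * b₂).natAbs * (D.natAbs : ℝ) ^ ε, by positivity, ?_⟩
  intro u w N huw hN hdvd
  have hne := huw.ne_zero_or_ne_zero
  -- nonvanishing of the members
  have hL0 : (a₁ * u + b₁ * w) * (a₂ * u + b₂ * w) * (a₃ * u + b₃ * w) ≠ 0 := by
    intro h; obtain ⟨c, hc⟩ := hdvd; exact hN (by rw [hc, h, zero_mul])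
  have hL1 : a₁ * u + b₁ * w ≠ 0 := fun h => hL0 (by rw [h]; ring)
  have hL2 : a₂ * u + b₂ * w ≠ 0 := fun h => hL0 (by rw [h]; ring)
  have hL3 : a₃ * u + b₃ * w ≠ 0 := fun h => hL0 (by rw [h]; ring)
  -- the sub-pencil identity `X + Y = Z`
  set X : ℤ := (a₂ * b₃ - a₃ * b₂) * (a₁ * u + b₁ * w) with hXdef
  set Y : ℤ := (a₃ * b₁ - a₁ * b₃) * (a₂ * u + b₂ * w) with hYdef
  set Z : ℤ := -((a₁ * b₂ - a₂ * b₁) * (a₃ * u + b₃ * w)) with hZdef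
  have hXYZ : X + Y = Z := by rw [hXdef, hYdef, hZdef]; ring
  have hX0 : X ≠ 0 := mul_ne_zero hD23 hL1
  have hY0 : Y ≠ 0 := mul_ne_zero hD31 hL2
  have hZ0 : Z ≠ 0 := neg_ne_zero.mpr (mul_ne_zero hD12 hL3)
  -- remove the gcd
  set g : ℕ := Int.gcd X Y with hgdef
  have hg0 : 0 < g := Int.gcd_pos_of_ne_zero_left Y hX0
  have hgX : (g : ℤ) ∣ X := Int.gcd_dvd_left X Y
  have hgY : (g : ℤ) ∣ Y := Int.gcd_dvd_right X Y
  have hgZ : (g : ℤ) ∣ Z := hXYZ ▸ dvd_add hgX hgY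
  have hxX : X / g * g = X := Int.ediv_mul_cancel hgX
  have hyY : Y / g * g = Y := Int.ediv_mul_cancel hgY
  have hzZ : Z / g * g = Z := Int.ediv_mul_cancel hgZ
  have hx0 : X / g ≠ 0 := fun h => hX0 (by rw [← hxX, h, zero_mul])
  have hy0 : Y / g ≠ 0 := fun h => hY0 (by rw [← hyY, h, zero_mul])
  have hz0 : Z / g ≠ 0 := fun h => hZ0 (by rw [← hzZ, h, zero_mul])
  have hsum : X / g + Y / g = Z / g := by rw [← Int.add_ediv_of_dvd_left hgX, hXYZ]
  have hcop : IsCoprime (X / g) (Y / g) :=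
    Int.isCoprime_iff_gcd_eq_one.mpr (Int.gcd_div_gcd_div_gcd hg0)
  obtain ⟨r, hxr, hyr, hzr, hlogr⟩ := hB _ _ _ hx0 hy0 hz0 hsum hcop
  have hr0 : 0 < r := lt_of_lt_of_le (Int.natAbs_pos.mpr hx0) hxr
  -- the gcd divides `D`
  obtain ⟨s, t, hst⟩ := huw
  have hgD : (g : ℤ) ∣ D := by
    have key : D = ((a₃ * b₁ - a₁ * b₃) * (s * b₂ - t * a₂)) * X +
        ((a₂ * b₃ - a₃ * b₂) * (t * a₁ - s * b₁)) * Y := by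
      rw [hDdef, hXdef, hYdef]
      linear_combination (-((a₂ * b₃ - a₃ * b₂) * (a₃ * b₁ - a₁ * b₃) * (a₁ * b₂ - a₂ * b₁))) * hst
    rw [key]; exact dvd_add (dvd_mul_of_dvd_right hgX _) (dvd_mul_of_dvd_right hgY _)
  have hgle : g ≤ D.natAbs := Nat.le_of_dvd hDabs (Int.natCast_dvd.mp hgD)
  -- height: `|L₁| ≤ |X| = g |X/g| ≤ |D| r`, same for `L₂`, then Cramer
  have hXle : X.natAbs ≤ D.natAbs * r := by
    have h1 : X.natAbs = (X / g).natAbs * g := by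
      conv_lhs => rw [← hxX]
      rw [Int.natAbs_mul, Int.natAbs_natCast]
    rw [h1, mul_comm]
    exact Nat.mul_le_mul hgle hxr
  have hYle : Y.natAbs ≤ D.natAbs * r := by
    have h1 : Y.natAbs = (Y / g).natAbs * g := by
      conv_lhs => rw [← hyY]
      rw [Int.natAbs_mul, Int.natAbs_natCast]
    rw [h1, mul_comm]
    exact Nat.mul_le_mul hgle hyr
  have hL1le : (a₁ * u + b₁ * w).natAbs ≤ D.natAbs * r := by
    refine le_trans ?_ hXle
    rw [hXdef, Int.natAbs_mul]
    exact Nat.le_mul_of_pos_left _ (Int.natAbs_pos.mpr hD23)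
  have hL2le : (a₂ * u + b₂ * w).natAbs ≤ D.natAbs * r := by
    refine le_trans ?_ hYle
    rw [hYdef, Int.natAbs_mul]
    exact Nat.le_mul_of_pos_left _ (Int.natAbs_pos.mpr hD31)
  have hcu : (a₁ * b₂ - a₂ * b₁) * u = b₂ * (a₁ * u + b₁ * w) - b₁ * (a₂ * u + b₂ * w) := by ring
  have hcw : (a₁ * b₂ - a₂ * b₁) * w = a₁ * (a₂ * u + b₂ * w) - a₂ * (a₁ * u + b₁ * w) := by ring
  have hule : u.natAbs ≤ T * r := by
    calc u.natAbs ≤ ((a₁ * b₂ - a₂ * b₁) * u).natAbs := by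
          rw [Int.natAbs_mul]; exact Nat.le_mul_of_pos_left _ (Int.natAbs_pos.mpr hD12)
      _ ≤ (b₂ * (a₁ * u + b₁ * w)).natAbs + (b₁ * (a₂ * u + b₂ * w)).natAbs := by
          rw [hcu]; exact Int.natAbs_sub_le _ _
      _ = b₂.natAbs * (a₁ * u + b₁ * w).natAbs + b₁.natAbs * (a₂ * u + b₂ * w).natAbs := by
          rw [Int.natAbs_mul, Int.natAbs_mul]
      _ ≤ b₂.natAbs * (D.natAbs * r) + b₁.natAbs * (D.natAbs * r) :=
          Nat.add_le_add (Nat.mul_le_mul_left _ hL1le) (Nat.mul_le_mul_left _ hL2le)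
      _ = (b₂.natAbs + b₁.natAbs) * (D.natAbs * r) := by ring
      _ ≤ S * (D.natAbs * r) := Nat.mul_le_mul_right _ hS1
      _ = T * r := by rw [hTdef, mul_assoc]
  have hwle : w.natAbs ≤ T * r := by
    calc w.natAbs ≤ ((a₁ * b₂ - a₂ * b₁) * w).natAbs := by
          rw [Int.natAbs_mul]; exact Nat.le_mul_of_pos_left _ (Int.natAbs_pos.mpr hD12)
      _ ≤ (a₁ * (a₂ * u + b₂ * w)).natAbs + (a₂ * (a₁ * u + b₁ * w)).natAbs := by
          rw [hcw]; exact Int.natAbs_sub_le _ _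
      _ = a₁.natAbs * (a₂ * u + b₂ * w).natAbs + a₂.natAbs * (a₁ * u + b₁ * w).natAbs := by
          rw [Int.natAbs_mul, Int.natAbs_mul]
      _ ≤ a₁.natAbs * (D.natAbs * r) + a₂.natAbs * (D.natAbs * r) :=
          Nat.add_le_add (Nat.mul_le_mul_left _ hL2le) (Nat.mul_le_mul_left _ hL1le)
      _ = (a₁.natAbs + a₂.natAbs) * (D.natAbs * r) := by ring
      _ ≤ S * (D.natAbs * r) := Nat.mul_le_mul_right _ hS2
      _ = T * r := by rw [hTdef, mul_assoc]
  have hH : (max |u| |w| : ℤ) ≤ ((T * r : ℕ) : ℤ) := by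
    rw [max_le_iff, Int.abs_eq_natAbs, Int.abs_eq_natAbs]
    exact ⟨by exact_mod_cast hule, by exact_mod_cast hwle⟩
  have hH1 : (1 : ℤ) ≤ max |u| |w| := by
    rcases hne with hu | hw
    · exact le_max_of_le_left (Int.one_le_abs hu)
    · exact le_max_of_le_right (Int.one_le_abs hw)
  have hlogH : Real.log ((max |u| |w| : ℤ) : ℝ) ≤ Real.log T + Real.log r := by
    have hT0 : (0 : ℝ) < T := by exact_mod_cast hT1
    have hr0' : (0 : ℝ) < r := by exact_mod_cast hr0
    rw [← Real.log_mul hT0.ne' hr0'.ne']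
    have hH' : ((max |u| |w| : ℤ) : ℝ) ≤ (((T * r : ℕ) : ℤ) : ℝ) := Int.cast_le.mpr hH
    rw [Int.cast_natCast, Nat.cast_mul] at hH'
    have h0 : (0 : ℝ) < ((max |u| |w| : ℤ) : ℝ) := by
      have : ((1 : ℤ) : ℝ) ≤ ((max |u| |w| : ℤ) : ℝ) := Int.cast_le.mpr hH1
      rw [Int.cast_one] at this
      linarith
    exact Real.log_le_log h0 hH'
  -- the radical: `|(X/g)(Y/g)(Z/g)| ∣ |D| · |N|`
  have hxyz_dvd : X / g * (Y / g) * (Z / g) ∣ D * N := by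
    have h1 : X / g * (Y / g) * (Z / g) ∣ X * Y * Z :=
      mul_dvd_mul (mul_dvd_mul (Int.ediv_dvd_of_dvd hgX) (Int.ediv_dvd_of_dvd hgY))
        (Int.ediv_dvd_of_dvd hgZ)
    have h2 : X * Y * Z = -D * ((a₁ * u + b₁ * w) * (a₂ * u + b₂ * w) * (a₃ * u + b₃ * w)) := by
      rw [hXdef, hYdef, hZdef, hDdef]; ring
    have h3 : X * Y * Z ∣ D * N := by
      rw [h2]; exact mul_dvd_mul ((neg_dvd).mpr (dvd_refl D)) hdvd
    exact h1.trans h3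
  have hrad_le : ((radical (X / g * (Y / g) * (Z / g)).natAbs : ℕ) : ℝ) ≤
      D.natAbs * (((radical N).natAbs : ℕ) : ℝ) := by
    have h1 : (X / g * (Y / g) * (Z / g)).natAbs ∣ D.natAbs * N.natAbs := by
      rw [← Int.natAbs_mul]; exact Int.natAbs_dvd_natAbs.mpr hxyz_dvd
    have hDN : D.natAbs * N.natAbs ≠ 0 := mul_ne_zero hDabs.ne' (Int.natAbs_ne_zero.mpr hN)
    have h2 : radical (X / g * (Y / g) * (Z / g)).natAbs ∣ radical D.natAbs * radical N.natAbs :=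
      (radical_dvd_radical h1 hDN).trans radical_mul_dvd
    have h3 : radical (X / g * (Y / g) * (Z / g)).natAbs ≤ radical D.natAbs * radical N.natAbs :=
      Nat.le_of_dvd (Nat.mul_pos (Nat.radical_pos _) (Nat.radical_pos _)) h2
    have h4 : radical D.natAbs ≤ D.natAbs := Nat.radical_le_self_iff.mpr hDabs.ne'
    have h5 : (radical N).natAbs = radical N.natAbs := by
      rw [← Int.radical_natAbs_eq_radical, Int.natAbs_natCast]
    rw [h5]
    exact_mod_cast h3.trans (Nat.mul_le_mul_right _ h4)
  -- `P(|X/g|) ≤ |D₂₃| · P(|L₁|)`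
  have hP : largestPrimeFactor (X / g).natAbs ≤
      (a₂ * b₃ - a₃ * b₂).natAbs * largestPrimeFactor (a₁ * u + b₁ * w).natAbs := by
    calc largestPrimeFactor (X / g).natAbs ≤ largestPrimeFactor X.natAbs :=
          largestPrimeFactor_mono (Int.natAbs_dvd_natAbs.mpr (Int.ediv_dvd_of_dvd hgX))
            (Int.natAbs_ne_zero.mpr hX0)
      _ = largestPrimeFactor ((a₂ * b₃ - a₃ * b₂).natAbs * (a₁ * u + b₁ * w).natAbs) := by
          rw [hXdef, Int.natAbs_mul]
      _ ≤ largestPrimeFactor (a₂ * b₃ - a₃ * b₂).natAbs *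
            largestPrimeFactor (a₁ * u + b₁ * w).natAbs := largestPrimeFactor_mul_le _ _
      _ ≤ (a₂ * b₃ - a₃ * b₂).natAbs * largestPrimeFactor (a₁ * u + b₁ * w).natAbs :=
          Nat.mul_le_mul_right _ (largestPrimeFactor_le_self (Int.natAbs_ne_zero.mpr hD23))
  -- assemble in `ℝ`
  set P₁ : ℝ := (largestPrimeFactor (a₁ * u + b₁ * w).natAbs : ℝ) with hP₁
  set RN : ℝ := (((radical N).natAbs : ℕ) : ℝ) with hRN
  have hP1 : 1 ≤ P₁ := by rw [hP₁]; exact_mod_cast one_le_largestPrimeFactor _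
  have hRN1 : 1 ≤ RN := by
    rw [hRN]
    exact_mod_cast Nat.one_le_iff_ne_zero.mpr (Int.natAbs_ne_zero.mpr radical_ne_zero)
  have hRNε : 1 ≤ RN ^ ε := Real.one_le_rpow hRN1 hε.le
  have hDabs0 : (0 : ℝ) ≤ D.natAbs := Nat.cast_nonneg _
  have hrad_rpow : ((radical (X / g * (Y / g) * (Z / g)).natAbs : ℕ) : ℝ) ^ ε ≤
      (D.natAbs : ℝ) ^ ε * RN ^ ε := by
    rw [← Real.mul_rpow hDabs0 (by positivity)]
    exact Real.rpow_le_rpow (by positivity) hrad_le hε.le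
  have hP' : (largestPrimeFactor (X / g).natAbs : ℝ) ≤ (a₂ * b₃ - a₃ * b₂).natAbs * P₁ := by
    rw [hP₁]; exact_mod_cast hP
  have hmain : Real.log r ≤ K₁ * ((a₂ * b₃ - a₃ * b₂).natAbs * P₁) * ((D.natAbs : ℝ) ^ ε * RN ^ ε) :=
    calc Real.log r ≤ K₁ * largestPrimeFactor (X / g).natAbs *
          ((radical (X / g * (Y / g) * (Z / g)).natAbs : ℕ) : ℝ) ^ ε := hlogr
      _ ≤ K₁ * ((a₂ * b₃ - a₃ * b₂).natAbs * P₁) * ((D.natAbs : ℝ) ^ ε * RN ^ ε) :=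
          mul_le_mul (mul_le_mul_of_nonneg_left hP' hK₁.le) hrad_rpow (by positivity)
            (by positivity)
  calc Real.log ((max |u| |w| : ℤ) : ℝ) ≤ Real.log T + Real.log r := hlogH
    _ ≤ Real.log T * (P₁ * RN ^ ε) +
          K₁ * ((a₂ * b₃ - a₃ * b₂).natAbs * P₁) * ((D.natAbs : ℝ) ^ ε * RN ^ ε) :=
        add_le_add (le_mul_of_one_le_right hlogT (one_le_mul_of_one_le_of_one_le hP1 hRNε)) hmain
    _ = (Real.log T + K₁ * (a₂ * b₃ - a₃ * b₂).natAbs * (D.natAbs : ℝ) ^ ε) * P₁ * RN ^ ε := by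
        ring

end Summit.ABC.ABC.Theorems.PencilBoundLine

end
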